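import Summits.Ventures.YMGap.Census.VortexWronskianThreeCube
import Mathlib.Analysis.Calculus.Deriv.MeanValue
import HarnessLib

/-!
# Venture YMGap, track (b) census — headline C5 (monotone vortex ratio, Tomboulis (5.23)–(5.24)) on the `3³` torus, part 2/2:
# it HOLDS along the WHOLE one-character ray

HONEST FRAMING: venture file of the cell `pub-ymgap` (QuantumFields programme).  Exact statements about ONE finite torus `(ℤ/3ℤ)³`, the cut-off `J = 1`
and the vortex sheet in the `(0,1)`-plane; nothing about (5.15) in general, larger volumes, confinement or any limit.  From part 1
(`VortexWronskianThreeCube`: `wronskian333_nonpos`, every coefficient of `Z⁻′Z − Z⁻Z′` is `≤ 0`; table `Z333tw` = engine-1 `SU2_3x3x3_n1_w0.json` column `Z⁻`,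
ONE exact engine + independent low-order confirmation j158114 + referee F-66) this file derives `ratio333_antitoneOn` (mean-value theorem) and the CENSUS ROW
`vortexRatioAntitone_333` — T07 (5.24) HOLDS on `3³` for EVERY one-character coefficient vector with `c_{1/2} ≥ 0` — K-conditional on the displayed table
identities `TableIdentity333` (from `HypercubeExponentThreeCube`) and `TableIdentity333tw` (here; HYPOTHESIS SCHEMA, class C, NOT proved in the tree).
-/

noncomputable section

open Finset Real Set
open scoped BigOperators
open Literature.MathematicalPhysics.QuantumFieldTheory
open Literature.MathematicalPhysics.QuantumFieldTheory.Tomboulis2007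

namespace Summit.Ventures.YMGap.Census

/-- **KERNEL: the `3³` vortex ratio is antitone along the ray for EVERY `s₀ ≥ 0`** — `α ↦ Z⁻_{3³}(α s₀)/Z_{3³}(α s₀)` is antitone on `[0,1]`. [folklore] -/
theorem ratio333_antitoneOn {s₀ : ℝ} (h0 : 0 ≤ s₀) :
    AntitoneOn (fun α : ℝ => Z333tw (α * s₀) / Z333 (α * s₀)) (Icc 0 1) := by
  have hlin : ∀ α : ℝ, HasDerivAt (fun a : ℝ => a * s₀) s₀ α := fun α => by
    simpa using (hasDerivAt_id α).mul_const s₀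
  have hden : ∀ α : ℝ, HasDerivAt (fun a : ℝ => Z333 (a * s₀)) (Z333d (α * s₀) * s₀) α := fun α => by
    have h2 := HasDerivAt.comp α (hasDerivAt_Z333 (α * s₀)) (hlin α)
    simpa only [Function.comp_def] using h2
  have hnum : ∀ α : ℝ, HasDerivAt (fun a : ℝ => Z333tw (a * s₀)) (Z333twd (α * s₀) * s₀) α := fun α => by
    have h2 := HasDerivAt.comp α (hasDerivAt_Z333tw (α * s₀)) (hlin α)
    simpa only [Function.comp_def] using h2
  have hf : ∀ α : ℝ, 0 ≤ α → HasDerivAt (fun a : ℝ => Z333tw (a * s₀) / Z333 (a * s₀))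
      ((Z333twd (α * s₀) * s₀ * Z333 (α * s₀) - Z333tw (α * s₀) * (Z333d (α * s₀) * s₀)) / Z333 (α * s₀) ^ 2) α :=
    fun α hα => (hnum α).div (hden α) (Z333_pos (mul_nonneg hα h0)).ne'
  refine antitoneOn_of_deriv_nonpos (convex_Icc 0 1) (fun α hα => (hf α hα.1).continuousAt.continuousWithinAt)
    (fun α hα => ?_) ?_
  · rw [interior_Icc] at hα
    exact (hf α hα.1.le).differentiableAt.differentiableWithinAt
  intro α hα
  rw [interior_Icc] at hα
  rw [(hf α hα.1.le).deriv]
  have ht0 : 0 ≤ α * s₀ := mul_nonneg hα.1.le h0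
  have hW := wronskian333_nonpos ht0
  have hZ := Z333_pos ht0
  have hnumr : Z333twd (α * s₀) * s₀ * Z333 (α * s₀) - Z333tw (α * s₀) * (Z333d (α * s₀) * s₀) ≤ 0 := by
    have : Z333twd (α * s₀) * s₀ * Z333 (α * s₀) - Z333tw (α * s₀) * (Z333d (α * s₀) * s₀) =
        s₀ * (Z333twd (α * s₀) * Z333 (α * s₀) - Z333tw (α * s₀) * Z333d (α * s₀)) := by ring
    rw [this]
    exact mul_nonpos_of_nonneg_of_nonpos h0 hW
  exact div_nonpos_iff.mpr (Or.inr ⟨hnumr, by positivity⟩)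

/-- The vortex sheet `𝒱₀₁` of the `3³` torus (`d = 3`, `L = 3`: the three `(0,1)`-plaquettes based at `x₀ = x₁ = 0`). [folklore] -/
def sheet01three : Finset (Plaquette 3 3) :=
  vortexSheet 3 (0 : Fin 3) 1 (by decide)

/-- **TABLE IDENTITY for the twisted `3³` partition function** (HYPOTHESIS SCHEMA, class C — one exact engine + independent low-order confirmation; NOT
proved in the tree): `torusZtw 3 3 1 c 𝒱₀₁ = Z⁻_{3³}(c 1)`. [folklore] -/
def TableIdentity333tw : Prop :=
  ∀ c : ℕ → ℝ, torusZtw 3 3 1 c sheet01three = Z333tw (c 1)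

/-- **CENSUS ROW (K-conditional on the two table identities): Tomboulis (5.24) HOLDS on `3³` for EVERY one-character coefficient vector with `c_{1/2} ≥ 0`**
— `α ↦ Z⁻(α c)/Z(α c)` is antitone on `[0,1]` (`VortexRatioAntitone 3 3 1 c 𝒱₀₁`); census headline C5 on the first generic volume (engine-1: «N < 0 on the whole
ray, Sturm 0»). [cite: Tomboulis2007Confinement, §5 eqs. (5.23)–(5.24)] -/
theorem vortexRatioAntitone_333 (h : TableIdentity333) (htw : TableIdentity333tw) (c : ℕ → ℝ) (hc0 : 0 ≤ c 1) :
    VortexRatioAntitone 3 3 1 c sheet01three := by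
  unfold VortexRatioAntitone
  have hfun : (fun α : ℝ => vortexRatio 3 3 1 (scaleCoeff α c) sheet01three) = fun α : ℝ => Z333tw (α * c 1) / Z333 (α * c 1) := by
    funext α
    simp only [vortexRatio]
    rw [htw (scaleCoeff α c), h (scaleCoeff α c)]
    simp only [scaleCoeff]
  rw [hfun]
  exact ratio333_antitoneOn hc0

end Summit.Ventures.YMGap.Census
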